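import Summits.BirchSwinnertonDyer.Rank1Residual.GaloisImage.ThreeAdicTowerInertiaCriterion
import HarnessLib

/-!
# The INTERMEDIATE-FIELD ramification socket at `3`: an element fixed by `S ≤ Γ_ℚ` whose `3`-adic
# valuation has denominator `d` gives `d ∣ [I_𝔓 : I_𝔓 ∩ S]`
# (cell `b2b-bsdres`, team n1011, seat p02 gen 5 — row T-b11-F4 'scalar-stabiliser tower criterion',
# file F4a; Hilbert theory only, curve-free; generalises the gen-2 count socket p253264
# `dvd_card_inertia_map_galoisRepTorsion_of_valuation`, which is the case `S = ker ρ̄_{E,n}`)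

HONEST FRAMING (cell `b2b-bsdres`, run/shared/lean/b2b/bsd-rank1-residual/, verbatim in every
file): the goal of the cell is to DELETE the COMBINATION-SHAPED residual classes of the
Birch–Swinnerton-Dyer formula for ALL analytic-rank `≤ 1` elliptic curves over `ℚ` — "full BSD
formula for every rank `≤ 1` curve in class `C`" assembled STRICTLY from published theorems — so
that the rank-`≤ 1` remainder becomes exactly the CONSTRUCTION-SHAPED classes, which are TYPED
(missing-input `Prop`s), NOT attempted. This is not "finishing BSD". Team n1011 (N10 / N11):
research route; no claim beyond the stated classes; labels UNCHANGED; nothing is booked. Theorems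
only (no definition, no named fact).

## What this file proves

Let `L ⊆ ℚ̄` be finite Galois over `ℚ`, `𝔓` the prime of `\bar ℤ` of the place `v` over `3`,
`I = I_𝔓 ≤ Γ_ℚ` its inertia group, `P_L = 𝔓 ∩ 𝓞_L`, `I_L = I|_L` the inertia group of `P_L` in
`Gal(L/ℚ)` (`inertia_comap_eq_map_absRestrictNormalHom`).

* `exists_valuation_algebraMap_integralClosure_eq_exp` / `exists_valuation_eq_exp_card_inertia_mul`
  (§1) — for ANY intermediate field `T` of `L/ℚ` and a non-zero `x ∈ T` (first for `x ∈ 𝓞_T`, then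
  for quotients), the `P_L`-adic valuation of `x` is `exp(-(e · m))`, `m ∈ ℤ`, with
  `e = #(I_L ∩ Gal(L/T)) = e(P_L ∣ P_T)`: `w_{P_L} = e · w_{P_T}` on `𝓞_T`
  (`ord_algebraMap_integralClosure`, `ramificationIdx'_under_eq_card_inertia`).
* `exists_valuation_eq_exp_card_mul_of_mem_fixedField` (§1) — for a subgroup `Q ≤ I_L` and a
  non-zero `x` in the fixed field `T = L^Q`: `w_{P_L}(x) = exp(-(#Q · m))` (`Gal(L/T) = Q ≤ I_L`).
* **`dvd_relIndex_inertia_of_valuation`** (§2, the SOCKET) — if a non-zero `z ∈ L` is fixed by every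
  element of a subgroup `S ≤ Γ_ℚ` and `v(z)^d · v(3)^a = v(3)^b` with `d` coprime to `a − b` (the
  `3`-adic valuation of `z` has denominator `d` in lowest terms, up to the coprimality bookkeeping),
  then **`d ∣ [I_𝔓 : I_𝔓 ∩ S]`** (`Subgroup.relIndex`).  Proof: with `Q = S|_L ∩ I_L` and `T = L^Q ∋ z`,
  §1 gives `w_{P_L}(z) = exp(-#Q·m)`, Hilbert theory gives `w_{P_L}(3) = exp(-#I_L)`
  (`ord_algebraMap_eq_card_inertia_of_mem_primesAbove`), so the identity reads
  `d · #Q · m = (b − a) · #I_L = (b − a) · #Q · [I_L : Q]`, whence `d ∣ [I_L : Q]`; and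
  `[I_L : Q] = [I_L : I_L ∩ S|_L] ∣ [I : I ∩ S]` (`Subgroup.relIndex_comap`, `Subgroup.le_comap_map`).
* `dvd_relIndex_inertia_of_valuation_divisionField` (§2) — the same with `L = ℚ(E[n])`, the shape
  consumed by F4b `GaloisImage/NineTorsionScalarStabiliserSocket.lean` (`S = Stab C`, `9 ∣ d`).

The point of the intermediate version: an invariant of a SUB-configuration (a cyclic `9`-subgroup
`C`, say) sees the ramification of the smaller field `ℚ(C)`.  Nothing booked; no label change.

References: [SerreLocalFields1979] Ch. I §4 (index `e`), §7 Prop. 20–22, Cor. to Prop. 21.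
-/

noncomputable section

open scoped Classical NumberField Pointwise
open Field IsDedekindDomain WeierstrassCurve

-- As in `ThreeAdicTowerInertiaCount`: pin `Algebra ℚ ℚ̄` to `AlgebraicClosure.instAlgebra` (the
-- instance under which `absoluteGaloisGroup ℚ`, `divisionField`, `absIntegers` are stated).
attribute [local instance 1001] IntermediateField.algebra'
attribute [local instance 1002] AlgebraicClosure.instAlgebra

namespace Summit.BirchSwinnertonDyer.Rank1Residual.GaloisImage

open Literature.NumberTheory.EllipticCurves Literature.NumberTheory.GaloisRepresentations
  Rat.HeightOneSpectrum

/-! ### §0 The place at `3` -/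

/-- `3 ∈ v` and `3 ∉ v²` for the place `v` of `ℚ` at `3` (`v = (3)` in `𝓞 ℚ ≅ ℤ`). [folklore] -/
theorem three_mem_and_three_not_mem_sq {v : HeightOneSpectrum (𝓞 ℚ)}
    (hv : (primesEquiv v : ℕ) = 3) :
    ((3 : ℕ) : 𝓞 ℚ) ∈ v.asIdeal ∧ ((3 : ℕ) : 𝓞 ℚ) ∉ v.asIdeal ^ 2 := by
  have hgen : natGenerator v = 3 := hv
  set e := Rat.IsIntegralClosure.intEquiv (𝓞 ℚ) with he
  refine ⟨?_, ?_⟩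
  · have h := (natGenerator_dvd_iff v).mp (dvd_refl (natGenerator v))
    rw [hgen] at h
    rwa [← map_natCast e, Ideal.apply_mem_of_equiv_iff] at h
  · intro h3
    have h' : e ((3 : ℕ) : 𝓞 ℚ) ∈ (v.asIdeal ^ 2).map e := Ideal.mem_map_of_mem _ h3
    rw [Ideal.map_pow, ← span_natGenerator, hgen, Ideal.span_singleton_pow, map_natCast,
      Ideal.mem_span_singleton] at h'
    norm_num at h'

/-! ### §1 The valuation of `P_L` on the fixed field of a subgroup of the inertia group -/

section FixedField

variable (L : IntermediateField ℚ (AlgebraicClosure ℚ)) [FiniteDimensional ℚ L] [IsGalois ℚ L]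

/-- **`w_{P_L} = e(P_L ∣ P_T) · w_{P_T}` on `𝓞_T`, exponential form.**  For an intermediate field
`T` of the finite Galois `L/ℚ`, a non-zero prime `P_L` of `𝓞_L` with separable residue extension,
and a non-zero `y ∈ 𝓞_T`: `w_{P_L}(y) = exp(-(e · m))` with `e = #(T(P_L) ∩ Gal(L/T))`
(`= e(P_L ∣ P_T)`, `ramificationIdx'_under_eq_card_inertia`) and `m = v_{P_T}(y) ∈ ℕ`
(`ord_algebraMap_integralClosure`). [cite: SerreLocalFields1979, Ch. I §4 (before Prop. 11) and §7 Prop. 22(a)] -/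
theorem exists_valuation_algebraMap_integralClosure_eq_exp
    (w : HeightOneSpectrum (integralClosure (𝓞 ℚ) L))
    [Algebra.IsSeparable ((𝓞 ℚ) ⧸ w.asIdeal.under (𝓞 ℚ)) (integralClosure (𝓞 ℚ) L ⧸ w.asIdeal)]
    (T : IntermediateField ℚ L) {y : integralClosure (𝓞 ℚ) T} (hy0 : y ≠ 0) :
    haveI : IsDedekindDomain (integralClosure (𝓞 ℚ) L) := integralClosure.isDedekindDomain (𝓞 ℚ) ℚ L
    haveI : IsFractionRing (integralClosure (𝓞 ℚ) L) L :=
      integralClosure.isFractionRing_of_finite_extension ℚ L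
    ∃ m : ℕ, w.valuation L ((y : T) : L) =
      WithZero.exp (-((Nat.card (w.asIdeal.inertia T.fixingSubgroup) * m : ℕ) : ℤ)) := by
  haveI hDD : IsDedekindDomain (integralClosure (𝓞 ℚ) L) :=
    integralClosure.isDedekindDomain (𝓞 ℚ) ℚ L
  haveI : IsFractionRing (integralClosure (𝓞 ℚ) L) L :=
    integralClosure.isFractionRing_of_finite_extension ℚ L
  haveI hPLmax : w.asIdeal.IsMaximal := w.isPrime.isMaximal w.ne_bot
  have hPL0 : w.asIdeal ≠ ⊥ := w.ne_bot
  haveI hDDT : IsDedekindDomain (integralClosure (𝓞 ℚ) T) :=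
    integralClosure.isDedekindDomain (𝓞 ℚ) ℚ T
  letI algT : Algebra (integralClosure (𝓞 ℚ) T) (integralClosure (𝓞 ℚ) L) :=
    integralClosureAlgebra (𝓞 ℚ) T
  -- `e(P_L | P_T) = #(T(P_L) ∩ Gal(L/T))`
  obtain ⟨e', he'⟩ : ∃ e' : ℕ, e' = (@Ideal.under _ _ _ _ algT w.asIdeal).ramificationIdx'
      w.asIdeal := ⟨_, rfl⟩
  have he'card : e' = Nat.card (w.asIdeal.inertia T.fixingSubgroup) := by
    rw [he']
    exact ramificationIdx'_under_eq_card_inertia (𝓞 ℚ) T (K := ℚ) (L := L) w.asIdeal hPL0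
  have he'0 : (e' : ℕ∞) ≠ 0 := by
    rw [he'card]; exact_mod_cast Nat.card_pos.ne'
  -- `ord_{P_L}(y) = e' · ord_{P_T}(y)`
  have htr : ord w.asIdeal (algebraMap (integralClosure (𝓞 ℚ) T) (integralClosure (𝓞 ℚ) L) y) =
      e' * ord (@Ideal.under _ _ _ _ algT w.asIdeal) y := by
    rw [he']
    exact ord_algebraMap_integralClosure (𝓞 ℚ) T (K := ℚ) (L := L) _ hPL0 y
  -- the image `Y` of `y` in `𝓞_L` is non-zero, so `w(Y) = exp(-N)`
  obtain ⟨Y, hY⟩ : ∃ Y, algebraMap (integralClosure (𝓞 ℚ) T) (integralClosure (𝓞 ℚ) L) y = Y :=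
    ⟨_, rfl⟩
  have hYL : algebraMap (integralClosure (𝓞 ℚ) L) L Y = ((y : T) : L) := by rw [← hY]; rfl
  have hY0 : Y ≠ 0 := by
    intro h0
    apply hy0
    rw [← hY] at h0
    have hinj : Function.Injective
        (algebraMap (integralClosure (𝓞 ℚ) T) (integralClosure (𝓞 ℚ) L)) :=
      (faithfulSMul_iff_algebraMap_injective _ _).mp (integralClosure_faithfulSMul (𝓞 ℚ) T)
    exact hinj (h0.trans (map_zero _).symm)
  obtain ⟨N, hN⟩ : ∃ N : ℕ, w.intValuation Y = WithZero.exp (-(N : ℤ)) := by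
    rw [w.intValuation_if_neg hY0]
    exact ⟨_, rfl⟩
  have hordY : ord w.asIdeal Y = N :=
    (WeierstrassCurve.OggWild.ord_eq_natCast_iff_intValuation_eq w Y N).mpr hN
  -- `N = e' · m`
  rw [hY, hordY] at htr
  have key : ∃ m : ℕ, N = e' * m := by
    generalize ord (@Ideal.under _ _ _ _ algT w.asIdeal) y = q at htr
    induction q using ENat.recTopCoe with
    | top =>
      rw [ENat.mul_top he'0] at htr
      exact absurd htr (ENat.coe_ne_top N)
    | coe m => exact ⟨m, by exact_mod_cast htr⟩
  obtain ⟨m, hm⟩ := key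
  refine ⟨m, ?_⟩
  rw [← hYL, HeightOneSpectrum.valuation_of_algebraMap, hN, hm, he'card]

/-- The same for an arbitrary non-zero element `x` of the intermediate field `T` (a quotient of two
elements of `𝓞_T`): `w_{P_L}(x) = exp(-(e · m))` with `e = #(T(P_L) ∩ Gal(L/T))` and `m ∈ ℤ`.
[cite: SerreLocalFields1979, Ch. I §4 (before Prop. 11) and §7 Prop. 22(a)] -/
theorem exists_valuation_eq_exp_card_inertia_mul
    (w : HeightOneSpectrum (integralClosure (𝓞 ℚ) L))
    [Algebra.IsSeparable ((𝓞 ℚ) ⧸ w.asIdeal.under (𝓞 ℚ)) (integralClosure (𝓞 ℚ) L ⧸ w.asIdeal)]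
    (T : IntermediateField ℚ L) {x : L} (hxT : x ∈ T) (hx0 : x ≠ 0) :
    haveI : IsDedekindDomain (integralClosure (𝓞 ℚ) L) := integralClosure.isDedekindDomain (𝓞 ℚ) ℚ L
    haveI : IsFractionRing (integralClosure (𝓞 ℚ) L) L :=
      integralClosure.isFractionRing_of_finite_extension ℚ L
    ∃ m : ℤ, w.valuation L x =
      WithZero.exp (-((Nat.card (w.asIdeal.inertia T.fixingSubgroup) : ℤ) * m)) := by
  haveI hDD : IsDedekindDomain (integralClosure (𝓞 ℚ) L) :=
    integralClosure.isDedekindDomain (𝓞 ℚ) ℚ L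
  haveI : IsFractionRing (integralClosure (𝓞 ℚ) L) L :=
    integralClosure.isFractionRing_of_finite_extension ℚ L
  haveI : FiniteDimensional ℚ T := inferInstance
  haveI hDDT : IsDedekindDomain (integralClosure (𝓞 ℚ) T) :=
    integralClosure.isDedekindDomain (𝓞 ℚ) ℚ T
  letI algTT : Algebra (integralClosure (𝓞 ℚ) T) T := (integralClosure (𝓞 ℚ) T).toAlgebra
  haveI : IsScalarTower (integralClosure (𝓞 ℚ) T) T T := IsScalarTower.right
  haveI : IsFractionRing (integralClosure (𝓞 ℚ) T) T :=
    integralClosure.isFractionRing_of_finite_extension ℚ T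
  -- `x = x₁ / x₂` with `x₁, x₂ ∈ 𝓞_T`
  set xT : T := ⟨x, hxT⟩ with hxTdef
  obtain ⟨x₁, x₂, hx₂, hx⟩ := IsFractionRing.div_surjective (A := integralClosure (𝓞 ℚ) T) xT
  have hx₂0 : x₂ ≠ 0 := nonZeroDivisors.ne_zero hx₂
  have hxTL : ((xT : T) : L) = x := rfl
  have halg : ∀ y : integralClosure (𝓞 ℚ) T,
      algebraMap (integralClosure (𝓞 ℚ) T) T y = (y : T) := fun y ↦ rfl
  have hxL : x = ((x₁ : T) : L) / ((x₂ : T) : L) := by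
    rw [← hxTL, ← hx, IntermediateField.coe_div, halg, halg]
  have hx₁0 : x₁ ≠ 0 := by
    intro h0
    apply hx0
    rw [hxL, h0, ZeroMemClass.coe_zero, ZeroMemClass.coe_zero, zero_div]
  obtain ⟨m₁, hm₁⟩ := exists_valuation_algebraMap_integralClosure_eq_exp L w T hx₁0
  obtain ⟨m₂, hm₂⟩ := exists_valuation_algebraMap_integralClosure_eq_exp L w T hx₂0
  refine ⟨(m₁ : ℤ) - m₂, ?_⟩
  rw [hxL, map_div₀, hm₁, hm₂, ← WithZero.exp_sub]
  congr 1
  push_cast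
  ring

/-- **`w_{P_L}(x) ∈ exp(#Q · ℤ)` on the fixed field of `Q ≤ I(P_L)`.**  Let `P_L` be a non-zero
prime of `𝓞_L` (`L/ℚ` finite Galois) whose residue extension is separable, `Q` a subgroup of its
inertia group in `Gal(L/ℚ)`, and `T = L^Q`.  Then for every non-zero `x ∈ T` the `P_L`-adic valuation
of `x` is `exp(-(#Q · m))` for some `m ∈ ℤ`: by the previous lemma with `e(P_L ∣ P_T) =
#(T(P_L) ∩ Gal(L/T)) = #Q` (`Gal(L/T) = Q ≤ T(P_L)`).
[cite: SerreLocalFields1979, Ch. I §4 (before Prop. 11) and §7 Prop. 22(a)] -/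
theorem exists_valuation_eq_exp_card_mul_of_mem_fixedField
    (w : HeightOneSpectrum (integralClosure (𝓞 ℚ) L))
    [Algebra.IsSeparable ((𝓞 ℚ) ⧸ w.asIdeal.under (𝓞 ℚ)) (integralClosure (𝓞 ℚ) L ⧸ w.asIdeal)]
    (Q : Subgroup (L ≃ₐ[ℚ] L)) (hQ : Q ≤ w.asIdeal.inertia (L ≃ₐ[ℚ] L))
    {x : L} (hxT : x ∈ IntermediateField.fixedField Q) (hx0 : x ≠ 0) :
    haveI : IsDedekindDomain (integralClosure (𝓞 ℚ) L) := integralClosure.isDedekindDomain (𝓞 ℚ) ℚ L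
    haveI : IsFractionRing (integralClosure (𝓞 ℚ) L) L :=
      integralClosure.isFractionRing_of_finite_extension ℚ L
    ∃ m : ℤ, w.valuation L x = WithZero.exp (-((Nat.card Q : ℤ) * m)) := by
  have hfixT : (IntermediateField.fixedField Q).fixingSubgroup = Q :=
    IntermediateField.fixingSubgroup_fixedField Q
  -- every element of `Gal(L/T) = Q` lies in the inertia group
  have htop : w.asIdeal.inertia (IntermediateField.fixedField Q).fixingSubgroup = ⊤ := by
    rw [eq_top_iff]
    intro g _
    rw [← Ideal.ramificationSubgroup_zero, mem_ramificationSubgroup_subgroup_iff,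
      Ideal.ramificationSubgroup_zero]
    exact hQ (hfixT.le g.2)
  have hcard : Nat.card (w.asIdeal.inertia (IntermediateField.fixedField Q).fixingSubgroup) =
      Nat.card Q := by
    rw [htop, Subgroup.card_top, hfixT]
  obtain ⟨m, hm⟩ := exists_valuation_eq_exp_card_inertia_mul L w (IntermediateField.fixedField Q)
    hxT hx0
  exact ⟨m, by rw [hm, hcard]⟩
end FixedField

/-! ### §2 The socket: `d ∣ [I_𝔓 : I_𝔓 ∩ S]` -/

/-- **INTERMEDIATE-FIELD RAMIFICATION SOCKET.**  Let `L ⊆ ℚ̄` be finite Galois over `ℚ`, `𝔓` the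
prime of `\bar ℤ` of the place `v` over `3` with inertia group `I_𝔓 ≤ Γ_ℚ`, and `S ≤ Γ_ℚ` a
subgroup fixing a non-zero `z ∈ L`.  If `v(z)^d · v(3)^a = v(3)^b` with `d` coprime to `a − b`,
then `d ∣ [I_𝔓 : I_𝔓 ∩ S]` — the index (`Subgroup.relIndex S I_𝔓`) is a multiple of the
ramification index of `ℚ(z)` at `𝔓`, which the identity forces to be divisible by `d`.  With
`S = ker ρ̄_{E,n}` this is the count socket `dvd_card_inertia_map_galoisRepTorsion_of_valuation`.
[cite: SerreLocalFields1979, Ch. I §7 Cor. to Prop. 21 and Prop. 22] -/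
theorem dvd_relIndex_inertia_of_valuation
    {v : HeightOneSpectrum (𝓞 ℚ)} (hv : (primesEquiv v : ℕ) = 3)
    {𝔓 : Ideal (absIntegers (𝓞 ℚ) ℚ)}
    (hmem : ∀ x : absIntegers (𝓞 ℚ) ℚ, x ∈ 𝔓 ↔ (x : AlgebraicClosure ℚ) ∈ (placeOver 3).nonunits)
    (h𝔓 : 𝔓 ∈ v.primesAbove)
    (L : IntermediateField ℚ (AlgebraicClosure ℚ)) [FiniteDimensional ℚ L] [IsGalois ℚ L]
    {z : AlgebraicClosure ℚ} (hzL : z ∈ L) (hz0 : z ≠ 0)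
    (S : Subgroup (absoluteGaloisGroup ℚ)) (hS : ∀ σ ∈ S, σ • z = z) {d a b : ℕ}
    (hval : (placeOver 3).valuation z ^ d * (placeOver 3).valuation 3 ^ a =
      (placeOver 3).valuation 3 ^ b)
    (hcop : IsCoprime (d : ℤ) ((a : ℤ) - b)) :
    d ∣ S.relIndex (𝔓.inertia (absoluteGaloisGroup ℚ)) := by
  haveI : Fact (Nat.Prime 3) := ⟨Nat.prime_three⟩
  haveI : 𝔓.IsPrime := h𝔓.1
  haveI h𝔓max : 𝔓.IsMaximal := HeightOneSpectrum.isMaximal_of_mem_primesAbove h𝔓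
  haveI hDD : IsDedekindDomain (integralClosure (𝓞 ℚ) L) :=
    integralClosure.isDedekindDomain (𝓞 ℚ) ℚ L
  haveI : IsFractionRing (integralClosure (𝓞 ℚ) L) L :=
    integralClosure.isFractionRing_of_finite_extension ℚ L
  set PL := 𝔓.comap (L.integralClosureToAbsIntegers (𝓞 ℚ)) with hPL
  haveI hPLmax : PL.IsMaximal := isMaximal_comap_integralClosureToAbsIntegers (𝓞 ℚ) 𝔓 L
  obtain ⟨h3v, h3v2⟩ := three_mem_and_three_not_mem_sq hv
  -- `3 ∈ P_L`, so `P_L ≠ 0`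
  have h3PL : algebraMap (𝓞 ℚ) (integralClosure (𝓞 ℚ) L) ((3 : ℕ) : 𝓞 ℚ) ∈ PL := by
    have hunder : PL.under (𝓞 ℚ) = v.asIdeal := by
      rw [hPL, under_comap_integralClosureToAbsIntegers, ← h𝔓.2.over]
    have : ((3 : ℕ) : 𝓞 ℚ) ∈ PL.under (𝓞 ℚ) := by rw [hunder]; exact h3v
    rwa [Ideal.under_def, Ideal.mem_comap] at this
  have hPL0 : PL ≠ ⊥ := by
    intro h0
    rw [h0, Ideal.mem_bot] at h3PL
    have hinj : Function.Injective (algebraMap (𝓞 ℚ) (integralClosure (𝓞 ℚ) L)) :=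
      (faithfulSMul_iff_algebraMap_injective _ _).mp
        (faithfulSMul_integralClosure (𝓞 ℚ) (K := ℚ) (L := L))
    have h30 : ((3 : ℕ) : 𝓞 ℚ) = 0 := hinj (h3PL.trans (map_zero _).symm)
    apply h3v2
    rw [h30]
    exact Submodule.zero_mem _
  set w : HeightOneSpectrum (integralClosure (𝓞 ℚ) L) := ⟨PL, hPLmax.isPrime, hPL0⟩ with hw
  -- separability of the residue extension (finite residue field below)
  haveI : Finite ((𝓞 ℚ) ⧸ 𝔓.under (𝓞 ℚ)) := by
    rw [← h𝔓.2.over]; exact Ideal.finiteQuotientOfFreeOfNeBot v.asIdeal v.ne_bot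
  haveI hsep : Algebra.IsSeparable ((𝓞 ℚ) ⧸ w.asIdeal.under (𝓞 ℚ))
      (integralClosure (𝓞 ℚ) L ⧸ w.asIdeal) :=
    isSeparable_residue_comap (𝓞 ℚ) 𝔓 L
  -- Hilbert theory: `ord_{P_L}(3) = #I_L`, `I_L = I_𝔓|_L`
  set I := 𝔓.inertia (absoluteGaloisGroup ℚ) with hI
  set res := absRestrictNormalHom L with hres
  have hord := ord_algebraMap_eq_card_inertia_of_mem_primesAbove h𝔓 L h3v h3v2
  rw [map_natCast, Ideal.ramificationSubgroup_zero] at hord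
  set IL : Subgroup (L ≃ₐ[ℚ] L) := PL.inertia (L ≃ₐ[ℚ] L) with hIL
  have hILmap : IL = I.map res := by
    rw [hIL, hPL, hI, hres]
    exact inertia_comap_eq_map_absRestrictNormalHom (R := 𝓞 ℚ) 𝔓 L
  -- the subgroup `Q = S|_L ∩ I_L` and `#I_L = #Q · [I_L : Q]`
  set Q : Subgroup (L ≃ₐ[ℚ] L) := S.map res ⊓ IL with hQ
  have hQle : Q ≤ IL := inf_le_right
  have hQI : Q ≤ w.asIdeal.inertia (L ≃ₐ[ℚ] L) := hQle
  have hcardmul : Nat.card Q * Q.relIndex IL = Nat.card IL := by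
    rw [Subgroup.relIndex, ← Nat.card_congr (Subgroup.subgroupOfEquivOfLe hQle).toEquiv]
    exact Subgroup.card_mul_index _
  -- `z` lies in the fixed field of `Q`
  set zL : L := ⟨z, hzL⟩ with hzLdef
  have hzL0 : zL ≠ 0 := by
    intro h0
    apply hz0
    simpa [hzLdef] using congrArg (fun t : L ↦ (t : AlgebraicClosure ℚ)) h0
  have hzT : zL ∈ IntermediateField.fixedField Q := by
    rw [IntermediateField.mem_fixedField_iff]
    intro g hg
    obtain ⟨σ, hσS, hσg⟩ := Subgroup.mem_map.mp hg.1
    apply Subtype.ext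
    change (((g zL : L)) : AlgebraicClosure ℚ) = z
    rw [← hσg]
    exact (AlgEquiv.restrictNormal_commutes (absoluteGaloisGroup.toAlgEquiv ℚ σ) L zL).trans
      (hS σ hσS)
  -- §1: `w(z) = exp(-#Q·m)`; Hilbert: `w(3) = exp(-#I_L)`
  obtain ⟨m, hm⟩ := exists_valuation_eq_exp_card_mul_of_mem_fixedField L w Q hQI hzT hzL0
  have hw3 : w.valuation L (3 : L) = WithZero.exp (-(Nat.card IL : ℤ)) := by
    have h3alg : (3 : L) = algebraMap (integralClosure (𝓞 ℚ) L) L 3 := by rw [map_ofNat]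
    rw [h3alg, HeightOneSpectrum.valuation_of_algebraMap,
      ← WeierstrassCurve.OggWild.ord_eq_natCast_iff_intValuation_eq w
        (3 : integralClosure (𝓞 ℚ) L) (Nat.card IL)]
    have h3map : algebraMap (𝓞 ℚ) (integralClosure (𝓞 ℚ) L) ((3 : ℕ) : 𝓞 ℚ) = 3 := by
      rw [map_natCast]; rfl
    rw [← h3map]
    exact hord
  -- transfer the identity to `w`
  have h3L0 : (3 : L) ≠ 0 := three_ne_zero
  set t : L := zL ^ d * 3 ^ a * (3 ^ b)⁻¹ with ht
  have ht0 : t ≠ 0 :=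
    mul_ne_zero (mul_ne_zero (pow_ne_zero _ hzL0) (pow_ne_zero _ h3L0))
      (inv_ne_zero (pow_ne_zero _ h3L0))
  have hv30 : (placeOver 3).valuation ((3 : L) : AlgebraicClosure ℚ) ≠ 0 :=
    (Valuation.ne_zero_iff _).mpr (by exact_mod_cast (three_ne_zero : (3 : AlgebraicClosure ℚ) ≠ 0))
  have hval' : (placeOver 3).valuation (zL : AlgebraicClosure ℚ) ^ d *
      (placeOver 3).valuation ((3 : L) : AlgebraicClosure ℚ) ^ a =
        (placeOver 3).valuation ((3 : L) : AlgebraicClosure ℚ) ^ b := by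
    exact_mod_cast hval
  have hvt : (placeOver 3).valuation ((t : L) : AlgebraicClosure ℚ) = 1 := by
    rw [ht]
    push_cast
    rw [map_mul, map_mul, map_inv₀, map_pow, map_pow, map_pow, hval',
      mul_inv_cancel₀ (pow_ne_zero _ hv30)]
  have hwt := (valuation_placeOver_eq_one_iff_valuation_eq_one hmem w rfl ht0).mp hvt
  rw [ht, map_mul, map_mul, map_inv₀, map_pow, map_pow, map_pow, hw3, hm] at hwt
  have hexp0 : (WithZero.exp (-(Nat.card IL : ℤ)) : WithZero (Multiplicative ℤ)) ^ b ≠ 0 :=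
    pow_ne_zero _ WithZero.coe_ne_zero
  rw [mul_inv_eq_one₀ hexp0, ← WithZero.exp_nsmul, ← WithZero.exp_nsmul, ← WithZero.exp_nsmul,
    ← WithZero.exp_add, WithZero.exp_inj] at hwt
  simp only [nsmul_eq_mul] at hwt
  -- `d · #Q · m = (b − a) · #Q · [I_L : Q]`
  have hQpos : 0 < Nat.card Q := Nat.card_pos
  have hidx : (Nat.card IL : ℤ) = (Nat.card Q : ℤ) * (Q.relIndex IL : ℤ) := by
    exact_mod_cast hcardmul.symm
  have hkey : (d : ℤ) * m = ((b : ℤ) - a) * (Q.relIndex IL : ℤ) := by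
    have h1 : (Nat.card Q : ℤ) * ((d : ℤ) * m) =
        (Nat.card Q : ℤ) * (((b : ℤ) - a) * (Q.relIndex IL : ℤ)) := by
      have := hwt
      rw [hidx] at this
      linarith
    exact mul_left_cancel₀ (by exact_mod_cast hQpos.ne') h1
  have hcop' : IsCoprime (d : ℤ) ((b : ℤ) - a) := by
    have h := hcop.neg_right
    rwa [neg_sub] at h
  have hdvdQ : (d : ℤ) ∣ (Q.relIndex IL : ℤ) :=
    hcop'.dvd_of_dvd_mul_left ⟨m, by rw [← hkey]⟩
  have hdvdQ' : d ∣ Q.relIndex IL := by exact_mod_cast hdvdQ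
  -- `[I_L : Q] = [I_L : S|_L] ∣ [I : S]`
  have h1 : Q.relIndex IL = (S.map res).relIndex IL := by
    rw [hQ, Subgroup.inf_relIndex_right]
  have h2 : (S.map res).relIndex IL = ((S.map res).comap res).relIndex I := by
    rw [hILmap, Subgroup.relIndex_comap]
  have h3 : ((S.map res).comap res).relIndex I ∣ S.relIndex I :=
    Subgroup.relIndex_dvd_of_le_left I (Subgroup.le_comap_map res S)
  rw [h1, h2] at hdvdQ'
  exact hdvdQ'.trans h3

/-- **The socket for `L = ℚ(E[n])`**: if a non-zero `z ∈ ℚ(E[n])` is fixed by every element of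
`S ≤ Γ_ℚ` and `v(z)^d · v(3)^a = v(3)^b` with `d` coprime to `a − b`, then `d ∣ [I_𝔓 : I_𝔓 ∩ S]`.
(F4b `NineTorsionScalarStabiliserSocket` consumes this with `n = 9`, `S = Stab C`, `9 ∣ d`.)
[cite: SerreLocalFields1979, Ch. I §7 Cor. to Prop. 21 and Prop. 22] -/
theorem dvd_relIndex_inertia_of_valuation_divisionField {W : WeierstrassCurve ℚ} [W.IsElliptic]
    {n : ℕ} [NeZero n]
    {v : HeightOneSpectrum (𝓞 ℚ)} (hv : (primesEquiv v : ℕ) = 3)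
    {𝔓 : Ideal (absIntegers (𝓞 ℚ) ℚ)}
    (hmem : ∀ x : absIntegers (𝓞 ℚ) ℚ, x ∈ 𝔓 ↔ (x : AlgebraicClosure ℚ) ∈ (placeOver 3).nonunits)
    (h𝔓 : 𝔓 ∈ v.primesAbove)
    {z : AlgebraicClosure ℚ} (hzL : z ∈ W.divisionField n) (hz0 : z ≠ 0)
    (S : Subgroup (absoluteGaloisGroup ℚ)) (hS : ∀ σ ∈ S, σ • z = z) {d a b : ℕ}
    (hval : (placeOver 3).valuation z ^ d * (placeOver 3).valuation 3 ^ a =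
      (placeOver 3).valuation 3 ^ b)
    (hcop : IsCoprime (d : ℤ) ((a : ℤ) - b)) :
    d ∣ S.relIndex (𝔓.inertia (absoluteGaloisGroup ℚ)) :=
  dvd_relIndex_inertia_of_valuation hv hmem h𝔓 (W.divisionField n) hzL hz0 S hS hval hcop

end Summit.BirchSwinnertonDyer.Rank1Residual.GaloisImage

end
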